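import Summits.Ventures.LatticeQCDFlow.Exactness.FlowSamplerSquareIntegrableContraction
import HarnessLib

/-!
# EXACT autocorrelations of ODD observables under a SYMMETRIC flow: `Kᵏ g = rᵏ·g`, `ρ_g(k) = E_{g²}[rᵏ]/E[g²]`, `τ_int(g) = ½ + E_{g²}[r/(1 − r)]/E[g²]`

HONEST FRAMING: exact (Metropolis-corrected) sampling algorithms for lattice gauge theory;
figures of merit are autocorrelation/cost numbers at stated couplings and volumes; no
continuum-physics claim.  (SCALAR calibration rung S0-A: not a gauge result.)

Venture `LatticeQCDFlow` (cell pub-lqcd), topic `Exactness`; FANOUT row 2 (`s0-phi4`, FLOW arm: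
independence Metropolis `K = imhOp μ w q̃`).  NEW WORK of the cell over `FlowSamplerSquareIntegrable`
/ `…Contraction` (the jump + hold decomposition of `K` on `L¹(w)`) and Mathlib (dominated
convergence).  Nothing is cited as a fact.  Printed counterpart NAMED ONLY: Liu 1996 (the
eigen-analysis of the Metropolized independence sampler on a finite state space); the observation
below is elementary and we know no printed statement of it.

## The observation

Let `σ` be a symmetry of the reference measure (`∫ F ∘ σ dμ = ∫ F dμ` for all `F`) leaving the
target weight and the model density invariant (`w ∘ σ = w`, `q ∘ σ = q`), and let `g` be ODD
(`g ∘ σ = −g`).  The acceptance probability `α(t, t') = min(1, w(t')q(t)/(w(t)q(t')))` is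
`σ`-invariant in `t'`, so the JUMP part `∫ α(t,t') q(t') g(t') dt'` of `(K g)(t)` vanishes: an
accepted proposal lands on a `σ`-symmetric law and forgets the sign of `g` completely.  Hence the exact
flow sampler acts on odd observables DIAGONALLY, `(K g)(t) = r(t)·g(t)` with `r` the rejection
probability, `Kᵏ g = rᵏ g`, every autocovariance is EXACTLY its sticking moment
`C_g(k) = ∫ g² w rᵏ`, and the Green–Kubo series is the geometric series of the rejection odds:
`τ_int(g) = ½ + E_{g²w}[r/(1 − r)]/E[g²w]` — the summed sticking floor of `IMHStickingFloorSummed` /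
`Phi4FlowSquareIntegrableSticking` is ATTAINED.  For lattice φ⁴ (`S` even) with a `Z₂`-symmetric
model density `q̃(−φ) = q̃(φ)` and the magnetisation `M` this is `Phi4FlowSymmetricMagnetisationExact`.

## What is proved (`(X, μ)`; `w, q > 0` measurable, `q` integrable with `∫ q = 1`; `σ : X → X` with
`hσ : ∀ F, ∫ F (σ x) dμ = ∫ F dμ`, `w ∘ σ = w`, `q ∘ σ = q`; `r(t) = ∫ (1 − α(t,t')) q(t') dμ`)

* `imhAcceptQ_comp_symm_right` / `_left`, `rejection_comp_symm` — `α(t, σt') = α(t, t')`,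
  `α(σt, t') = α(t, t')`, `r ∘ σ = r`;
* **`imh_jump_eq_zero_of_odd`** — `∫ α(t,t') q(t') g(t') dμ(t') = 0` for odd `g`;
* **`imhOp_eq_rejection_mul_of_odd`** — `(K g)(t) = r(t) g(t)` for odd measurable `g ∈ L¹(w)`;
* **`imhOp_iterate_eq_of_odd`** — `(Kᵏ g)(t) = r(t)ᵏ g(t)` for every `k`;
* **`imhOp_autocov_eq_sticking_of_odd`** — `∫ g (Kᵏ g) w = ∫ g² w rᵏ` (any `k`);
* **`imhOp_hasSum_autocov_of_odd`** — `∫ g² w r/(1 − r) < ∞ ⇒ Σ_{k≥0} C_g(k+1) = ∫ g² w r/(1 − r)`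
  (`HasSum`; dominated convergence of the geometric partial sums, `r < 1` everywhere);
* **`imhOp_tauInt_eq_of_odd`** — with `P = ∫ g² w > 0`: **`τ_int(g) = ½ + (∫ g² w r/(1 − r))/P`**.

NOT CLAIMED: symmetry of any trained network (hypothesis on the flow; symmetrised proposals
`½(q̃(φ) + q̃(−φ))` satisfy it by construction); anything for even observables (energy, `M²`), for
which the jump part does not vanish; anything for the HMC / local arms; any number for any run.
-/

namespace Summit.Ventures.LatticeQCDFlow.Exactness

open Real MeasureTheory Filter Finset Set Topology
open Summit.Ventures.LatticeQCDFlow.Scoring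

section General

variable {X : Type*} [MeasurableSpace X] {μ : Measure X} [SFinite μ] {w q : X → ℝ} {σ : X → X}

omit [MeasurableSpace X] in
/-- The acceptance probability is invariant under the symmetry in the proposed state:
`α(t, σ t') = α(t, t')`. -/
theorem imhAcceptQ_comp_symm_right (hw : ∀ t, w (σ t) = w t) (hq : ∀ t, q (σ t) = q t) (t t' : X) :
    imhAcceptQ w q t (σ t') = imhAcceptQ w q t t' := by
  unfold imhAcceptQ
  rw [hw, hq]

omit [MeasurableSpace X] in
/-- … and in the current state: `α(σ t, t') = α(t, t')`. -/
theorem imhAcceptQ_comp_symm_left (hw : ∀ t, w (σ t) = w t) (hq : ∀ t, q (σ t) = q t) (t t' : X) :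
    imhAcceptQ w q (σ t) t' = imhAcceptQ w q t t' := by
  unfold imhAcceptQ
  rw [hw, hq]

omit [SFinite μ] in
/-- The rejection probability is `σ`-invariant: `r(σ t) = r(t)`. -/
theorem rejection_comp_symm (hw : ∀ t, w (σ t) = w t) (hq : ∀ t, q (σ t) = q t) (t : X) :
    ∫ t', (1 - imhAcceptQ w q (σ t) t') * q t' ∂μ = ∫ t', (1 - imhAcceptQ w q t t') * q t' ∂μ := by
  simp_rw [imhAcceptQ_comp_symm_left hw hq]

omit [SFinite μ] in
/-- **THE JUMP PART VANISHES ON ODD OBSERVABLES**: `∫ α(t,t') q(t') g(t') dμ(t') = 0` whenever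
`∫ F ∘ σ = ∫ F`, `w ∘ σ = w`, `q ∘ σ = q` and `g ∘ σ = −g` (substitute `t' ↦ σ t'`). -/
theorem imh_jump_eq_zero_of_odd (hσ : ∀ F : X → ℝ, ∫ x, F (σ x) ∂μ = ∫ x, F x ∂μ)
    (hw : ∀ t, w (σ t) = w t) (hq : ∀ t, q (σ t) = q t) {g : X → ℝ} (hg : ∀ t, g (σ t) = -g t)
    (t : X) : ∫ t', imhAcceptQ w q t t' * q t' * g t' ∂μ = 0 := by
  have h := hσ (fun t' => imhAcceptQ w q t t' * q t' * g t')
  have e : (fun x => imhAcceptQ w q t (σ x) * q (σ x) * g (σ x))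
      = fun x => -(imhAcceptQ w q t x * q x * g x) := by
    funext x
    rw [imhAcceptQ_comp_symm_right hw hq, hq, hg]
    ring
  rw [e, integral_neg] at h
  linarith

omit [SFinite μ] in
/-- **THE FLOW SAMPLER IS DIAGONAL ON ODD OBSERVABLES**: for odd measurable `g` with `g w ∈ L¹`,
`(K g)(t) = r(t) · g(t)` with `r(t) = ∫ (1 − α(t,t')) q(t') dμ(t')` the rejection probability. -/
theorem imhOp_eq_rejection_mul_of_odd (hw0 : ∀ t, 0 < w t) (hwm : Measurable w)
    (hq0 : ∀ t, 0 < q t) (hqm : Measurable q) (hqi : Integrable q μ) (hq1 : ∫ t, q t ∂μ = 1)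
    (hσ : ∀ F : X → ℝ, ∫ x, F (σ x) ∂μ = ∫ x, F x ∂μ) (hw : ∀ t, w (σ t) = w t)
    (hq : ∀ t, q (σ t) = q t) {g : X → ℝ} (hgm : Measurable g)
    (hgw : Integrable (fun t => g t * w t) μ) (hg : ∀ t, g (σ t) = -g t) (t : X) :
    imhOp μ w q g t = (∫ t', (1 - imhAcceptQ w q t t') * q t' ∂μ) * g t := by
  rw [imhOp_eq_jump_add_hold_of_mul_weight hw0 hwm hq0 hqm hqi hq1 hgm hgw t,
    imh_jump_eq_zero_of_odd hσ hw hq hg t, zero_add]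
  congr 1
  have e' : ∀ t', (1 - imhAcceptQ w q t t') * q t' = q t' - imhAcceptQ w q t t' * q t' :=
    fun t' => by ring
  simp_rw [e']
  rw [integral_sub hqi (integrable_imhAcceptQ_mul hw0 hwm hq0 hqm hqi t), hq1]

/-- **`Kᵏ g = rᵏ · g` for odd observables**: by induction, since `r ∘ σ = r` keeps `r·g` odd and
`|r| ≤ 1` keeps it in `L¹(w)`. -/
theorem imhOp_iterate_eq_of_odd (hw0 : ∀ t, 0 < w t) (hwm : Measurable w)
    (hq0 : ∀ t, 0 < q t) (hqm : Measurable q) (hqi : Integrable q μ) (hq1 : ∫ t, q t ∂μ = 1)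
    (hσ : ∀ F : X → ℝ, ∫ x, F (σ x) ∂μ = ∫ x, F x ∂μ) (hw : ∀ t, w (σ t) = w t)
    (hq : ∀ t, q (σ t) = q t) :
    ∀ (k : ℕ) {g : X → ℝ}, Measurable g → Integrable (fun t => g t * w t) μ →
      (∀ t, g (σ t) = -g t) → ∀ t,
      ((imhOp μ w q)^[k] g) t = (∫ t', (1 - imhAcceptQ w q t t') * q t' ∂μ) ^ k * g t
  | 0, _, _, _, _, t => by simp
  | k + 1, g, hgm, hgw, hg, t => by
    obtain ⟨hr0, hr1, hrm⟩ := rejection_bounds (μ := μ) hw0 hwm hq0 hqm hqi hq1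
    have e : imhOp μ w q g = fun s => (∫ t', (1 - imhAcceptQ w q s t') * q t' ∂μ) * g s :=
      funext fun s => imhOp_eq_rejection_mul_of_odd hw0 hwm hq0 hqm hqi hq1 hσ hw hq hgm hgw hg s
    -- `r·g` is measurable, in `L¹(w)`, and odd
    have h1 : Measurable fun s => (∫ t', (1 - imhAcceptQ w q s t') * q t' ∂μ) * g s := hrm.mul hgm
    have h2 : Integrable (fun s => (∫ t', (1 - imhAcceptQ w q s t') * q t' ∂μ) * g s * w s) μ := by
      refine Integrable.mono' hgw.abs (h1.mul hwm).aestronglyMeasurable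
        (Eventually.of_forall fun s => ?_)
      rw [Real.norm_eq_abs, abs_mul, abs_mul, abs_of_nonneg (hr0 s), abs_mul]
      calc (∫ t', (1 - imhAcceptQ w q s t') * q t' ∂μ) * |g s| * |w s| ≤ 1 * |g s| * |w s| :=
            mul_le_mul_of_nonneg_right (mul_le_mul_of_nonneg_right (hr1 s) (abs_nonneg _))
              (abs_nonneg _)
        _ = |g s| * |w s| := by ring
    have h3 : ∀ s, (∫ t', (1 - imhAcceptQ w q (σ s) t') * q t' ∂μ) * g (σ s)
        = -((∫ t', (1 - imhAcceptQ w q s t') * q t' ∂μ) * g s) := fun s => by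
      rw [rejection_comp_symm hw hq, hg]; ring
    rw [Function.iterate_succ_apply, e, imhOp_iterate_eq_of_odd hw0 hwm hq0 hqm hqi hq1 hσ hw hq k h1
      h2 h3 t]
    ring

/-- **EVERY AUTOCOVARIANCE OF AN ODD OBSERVABLE IS EXACTLY ITS STICKING MOMENT**:
`∫ g (Kᵏ g) w dμ = ∫ g² w rᵏ dμ`. -/
theorem imhOp_autocov_eq_sticking_of_odd (hw0 : ∀ t, 0 < w t) (hwm : Measurable w)
    (hq0 : ∀ t, 0 < q t) (hqm : Measurable q) (hqi : Integrable q μ) (hq1 : ∫ t, q t ∂μ = 1)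
    (hσ : ∀ F : X → ℝ, ∫ x, F (σ x) ∂μ = ∫ x, F x ∂μ) (hw : ∀ t, w (σ t) = w t)
    (hq : ∀ t, q (σ t) = q t) {g : X → ℝ} (hgm : Measurable g)
    (hgw : Integrable (fun t => g t * w t) μ) (hg : ∀ t, g (σ t) = -g t) (k : ℕ) :
    ∫ t, g t * ((imhOp μ w q)^[k] g) t * w t ∂μ
      = ∫ t, g t ^ 2 * w t * (∫ t', (1 - imhAcceptQ w q t t') * q t' ∂μ) ^ k ∂μ := by
  refine integral_congr_ae (Eventually.of_forall fun t => ?_)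
  show g t * ((imhOp μ w q)^[k] g) t * w t = g t ^ 2 * w t * (∫ t', (1 - imhAcceptQ w q t t') * q t' ∂μ) ^ k
  rw [imhOp_iterate_eq_of_odd hw0 hwm hq0 hqm hqi hq1 hσ hw hq k hgm hgw hg t]
  ring

/-- **THE GREEN–KUBO SERIES OF AN ODD OBSERVABLE IS THE GEOMETRIC SERIES OF THE REJECTION ODDS**:
if `∫ g² w r/(1 − r) dμ < ∞` then `Σ_{k≥0} C_g(k+1) = ∫ g² w r/(1 − r) dμ` as a `HasSum` (`r < 1`
everywhere; dominated convergence of the geometric partial sums). -/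
theorem imhOp_hasSum_autocov_of_odd (hw0 : ∀ t, 0 < w t) (hwm : Measurable w) (hwi : Integrable w μ)
    (hq0 : ∀ t, 0 < q t) (hqm : Measurable q) (hqi : Integrable q μ) (hq1 : ∫ t, q t ∂μ = 1)
    (hσ : ∀ F : X → ℝ, ∫ x, F (σ x) ∂μ = ∫ x, F x ∂μ) (hw : ∀ t, w (σ t) = w t)
    (hq : ∀ t, q (σ t) = q t) {g : X → ℝ} (hgm : Measurable g)
    (hg2 : Integrable (fun t => g t ^ 2 * w t) μ) (hg : ∀ t, g (σ t) = -g t)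
    (hS : Integrable (fun t => g t ^ 2 * w t * ((∫ t', (1 - imhAcceptQ w q t t') * q t' ∂μ)
      / (1 - ∫ t', (1 - imhAcceptQ w q t t') * q t' ∂μ))) μ) :
    HasSum (fun k => ∫ t, g t * ((imhOp μ w q)^[k + 1] g) t * w t ∂μ)
      (∫ t, g t ^ 2 * w t * ((∫ t', (1 - imhAcceptQ w q t t') * q t' ∂μ)
        / (1 - ∫ t', (1 - imhAcceptQ w q t t') * q t' ∂μ)) ∂μ) := by
  obtain ⟨hr0, hr1, hrm⟩ := rejection_bounds (μ := μ) hw0 hwm hq0 hqm hqi hq1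
  set r : X → ℝ := fun t => ∫ t', (1 - imhAcceptQ w q t t') * q t' ∂μ with hr
  have hgw := integrable_mul_weight_of_sq (fun t => (hw0 t).le) hwm hwi hgm hg2
  have hrlt : ∀ t, r t < 1 := fun t => by
    show (∫ t', (1 - imhAcceptQ w q t t') * q t' ∂μ) < 1
    rw [rejection_eq_rejCurve hw0 hq0 t]
    exact rejCurve_lt_one hw0 hwm hq0 hqm hqi hq1 (div_pos (hw0 t) (hq0 t))
  -- the geometric series of the odds, pointwise
  have hgeo : ∀ t, HasSum (fun k => r t ^ (k + 1)) (r t / (1 - r t)) := by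
    intro t
    have h := (hasSum_geometric_of_lt_one (hr0 t) (hrlt t)).mul_left (r t)
    have e : r t * (1 - r t)⁻¹ = r t / (1 - r t) := by rw [div_eq_mul_inv]
    rw [e] at h
    exact h.congr_fun fun k => by ring
  -- termwise: `C(k+1) = ∫ g² w r^{k+1}`, each term nonnegative
  have hterm : ∀ k, ∫ t, g t * ((imhOp μ w q)^[k + 1] g) t * w t ∂μ = ∫ t, g t ^ 2 * w t * r t ^ (k + 1) ∂μ :=
    fun k => imhOp_autocov_eq_sticking_of_odd hw0 hwm hq0 hqm hqi hq1 hσ hw hq hgm hgw hg (k + 1)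
  have hnn : ∀ k, 0 ≤ ∫ t, g t * ((imhOp μ w q)^[k + 1] g) t * w t ∂μ := fun k => by
    rw [hterm k]
    exact integral_nonneg fun t => mul_nonneg (mul_nonneg (sq_nonneg _) (hw0 t).le) (pow_nonneg (hr0 t) _)
  have hterm_int : ∀ k, Integrable (fun t => g t ^ 2 * w t * r t ^ (k + 1)) μ := by
    intro k
    refine Integrable.mono' hg2 (((hgm.pow_const 2).mul hwm).mul (hrm.pow_const _)).aestronglyMeasurable
      (Eventually.of_forall fun t => ?_)
    rw [Real.norm_eq_abs, abs_of_nonneg (mul_nonneg (mul_nonneg (sq_nonneg _) (hw0 t).le)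
      (pow_nonneg (hr0 t) _))]
    exact mul_le_of_le_one_right (mul_nonneg (sq_nonneg _) (hw0 t).le) (pow_le_one₀ (hr0 t) (hr1 t))
  -- partial sums as one integral, and dominated convergence
  rw [hasSum_iff_tendsto_nat_of_nonneg hnn]
  have hpart : ∀ N, ∑ k ∈ Finset.range N, ∫ t, g t * ((imhOp μ w q)^[k + 1] g) t * w t ∂μ
      = ∫ t, g t ^ 2 * w t * ∑ k ∈ Finset.range N, r t ^ (k + 1) ∂μ := by
    intro N
    simp_rw [hterm]
    rw [← integral_finsetSum _ fun k _ => hterm_int k]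
    refine integral_congr_ae (Eventually.of_forall fun t => ?_)
    simp only [Finset.mul_sum]
  simp_rw [hpart]
  refine tendsto_integral_of_dominated_convergence
    (fun t => g t ^ 2 * w t * (r t / (1 - r t)))
    (fun N => (((hgm.pow_const 2).mul hwm).mul
      (Finset.measurable_sum _ fun k _ => hrm.pow_const _)).aestronglyMeasurable) hS
    (fun N => Eventually.of_forall fun t => ?_) (Eventually.of_forall fun t => ?_)
  · have hs0 : 0 ≤ ∑ k ∈ Finset.range N, r t ^ (k + 1) := Finset.sum_nonneg fun k _ => pow_nonneg (hr0 t) _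
    rw [Real.norm_eq_abs, abs_of_nonneg (mul_nonneg (mul_nonneg (sq_nonneg _) (hw0 t).le) hs0)]
    refine mul_le_mul_of_nonneg_left ?_ (mul_nonneg (sq_nonneg _) (hw0 t).le)
    exact sum_le_hasSum (Finset.range N) (fun k _ => pow_nonneg (hr0 t) _) (hgeo t)
  · exact ((hgeo t).tendsto_sum_nat).const_mul _

/-- **THE EXACT INTEGRATED AUTOCORRELATION TIME OF AN ODD OBSERVABLE UNDER A SYMMETRIC FLOW**:
`w, q > 0` measurable integrable, `∫ q = 1`; `σ` a symmetry of `μ`, `w`, `q`; `g` odd, measurable,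
`P = ∫ g² w < ∞`, `∫ g² w r/(1 − r) < ∞`.  Then the normalised series is summable and
**`τ_int(g) = ½ + (∫ g² w r/(1 − r) dμ)/P = ½ + E_{g²w}[r/(1 − r)]`** — the `g²`-weighted mean number
of consecutive rejections, plus one half; nothing else. -/
theorem imhOp_tauInt_eq_of_odd (hw0 : ∀ t, 0 < w t) (hwm : Measurable w) (hwi : Integrable w μ)
    (hq0 : ∀ t, 0 < q t) (hqm : Measurable q) (hqi : Integrable q μ) (hq1 : ∫ t, q t ∂μ = 1)
    (hσ : ∀ F : X → ℝ, ∫ x, F (σ x) ∂μ = ∫ x, F x ∂μ) (hw : ∀ t, w (σ t) = w t)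
    (hq : ∀ t, q (σ t) = q t) {g : X → ℝ} (hgm : Measurable g)
    (hg2 : Integrable (fun t => g t ^ 2 * w t) μ) (hg : ∀ t, g (σ t) = -g t)
    (hS : Integrable (fun t => g t ^ 2 * w t * ((∫ t', (1 - imhAcceptQ w q t t') * q t' ∂μ)
      / (1 - ∫ t', (1 - imhAcceptQ w q t t') * q t' ∂μ))) μ) :
    (Summable fun k => (∫ t, g t * ((imhOp μ w q)^[k + 1] g) t * w t ∂μ) / ∫ t, g t ^ 2 * w t ∂μ) ∧
    tauInt (fun k => (∫ t, g t * ((imhOp μ w q)^[k] g) t * w t ∂μ) / ∫ t, g t ^ 2 * w t ∂μ)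
      = 1 / 2 + (∫ t, g t ^ 2 * w t * ((∫ t', (1 - imhAcceptQ w q t t') * q t' ∂μ)
          / (1 - ∫ t', (1 - imhAcceptQ w q t t') * q t' ∂μ)) ∂μ) / ∫ t, g t ^ 2 * w t ∂μ := by
  have h := (imhOp_hasSum_autocov_of_odd hw0 hwm hwi hq0 hqm hqi hq1 hσ hw hq hgm hg2 hg hS).div_const
    (∫ t, g t ^ 2 * w t ∂μ)
  refine ⟨h.summable, ?_⟩
  unfold tauInt
  rw [h.tsum_eq]

end General

end Summit.Ventures.LatticeQCDFlow.Exactness
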